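import Summits.AtomisticToContinuum.BoseEinsteinCondensation.Theorems.BECConjugateDominationHardCoreExtensionTruncationReduction
import Summits.AtomisticToContinuum.BoseEinsteinCondensation.Theorems.BECConjugateDominationHardCoreExtensionGradientCauchy
import Literature.MathematicalPhysics.QuantumManyBody.PeriodicKineticBudget
import Literature.MathematicalPhysics.QuantumManyBody.PeriodicClusteringFromKyFanGap
import HarnessLib

/-!
# Kinetic tightness of truncation minimisers (line `third-law-current-floor`, crux `HardCoreExtension`,
# stmt-AtomisticToContinuum-11786; nodes P1 + P3 of the (α') plan)

At fixed `(N, L)`, `L > 0`, let `vₙ = min(v, n)` be the truncations of a measurable pair potential `v` and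
`Ψₙ` exact minimisers of the truncated periodic energies with `E₀(vₙ) = E_{vₙ}[Ψₙ] ≤ B < ⊤`. Then along a
subsequence `φ` the kinetic energy of `Ψ_{φ i}` does NOT concentrate on any Lebesgue-null subset of the cell
approached by a shrinking measurable family `S k` (e.g. shells around the hard wall):
for every `ε > 0` there are `k₀, i₀` with `∫_{S k ∩ cell} |∇Ψ_{φ i}|² ≤ ε` for all `k ≥ k₀`, `i ≥ i₀`
(`stub_truncationMinimisersKineticTightness`).

Proof. (P1) Rellich through the free form domain (`exists_limitProfile_of_seq`) gives a subsequence whose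
embedded classes converge in `L²((ℝ/ℤ)^{3N})`; by the isometry `norm_formEmbed_sub_sq_trialState` the
subsequence is Cauchy in `L²(cell)`. (P2) The gradient-Cauchy estimate
`∫_cell |∇(Ψₙ − Ψₘ)|² ≤ 2(E₀(vₙ) − E₀(vₘ)) + E₀(vₘ)·∫_cell |Ψₙ − Ψₘ|²` (`m ≤ n`; parallelogram law for the
`vₘ`-form, `stub_truncationMinimisersGradientCauchy` of the sibling file
`…HardCoreExtensionGradientCauchy.lean`), together with the monotone convergence of the bounded
sequence `E₀(vₙ) ≤ B`, makes the gradients Cauchy in `L²(cell)`. (P3) Pointwise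
`|∇Ψᵢ|² ≤ 2|∇Ψ_{i₀}|² + 2|∇(Ψᵢ − Ψ_{i₀})|²`; the second term is small on the whole cell by (P1)+(P2), the
first is small on `S k ∩ cell` for `k` large by absolute continuity of the finite integral
`∫_cell |∇Ψ_{i₀}|² ≤ B` (`tendsto_setLIntegral_zero` + continuity from above of the measure). [folklore;
the convexity argument of LiebLoss2001 Thm 11.8]
-/

noncomputable section

namespace Summit.AtomisticToContinuum.BoseEinsteinCondensation.Cruxes.HardCoreExtension.ThirdLawCurrentFloor

open MeasureTheory Filter
open scoped ENNReal NNReal BigOperators Topology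
open Literature.MathematicalPhysics.QuantumManyBody.BoseGas

namespace KineticTightness

variable {N : ℕ} {L : ℝ}

/-! ### (P1) An `L²(cell)`-Cauchy subsequence -/

/-- **`L²(cell)`-Cauchy subsequence** of a sequence of trial states with bounded truncated energies: Rellich
through the free form domain (`exists_limitProfile_of_seq`; a convergent sequence is Cauchy) and the isometry
`norm_formEmbed_sub_sq_trialState` on differences; the squared distance is finite (`≤ 4`). [folklore] -/
theorem exists_subseq_sq_cauchy {v : ℝ → ℝ≥0∞} (hv : Measurable v) (hL : 0 < L) {B : ℝ≥0∞}
    (hB : B ≠ ⊤) (Ψ : ℕ → PeriodicTrialState N L)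
    (hΨ : ∀ n : ℕ, periodicEnergy (fun r => min (v r) (n : ℝ≥0∞)) (Ψ n) ≤ B) :
    ∃ φ : ℕ → ℕ, StrictMono φ ∧ ∀ δ : ℝ, 0 < δ → ∃ I : ℕ, ∀ i j : ℕ, I ≤ i → I ≤ j →
      ∫⁻ X in cellN N L, ((‖(Ψ (φ i)).ψ X - (Ψ (φ j)).ψ X‖₊ : ℝ≥0∞)) ^ 2 ≤ ENNReal.ofReal δ := by
  obtain ⟨η, φ, hφ, hconv, -, -, -⟩ := exists_limitProfile_of_seq hv hL hB Ψ hΨ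
  refine ⟨φ, hφ, fun δ hδ => ?_⟩
  obtain ⟨I, hI⟩ := Metric.cauchySeq_iff.1 hconv.cauchySeq (Real.sqrt δ) (by positivity)
  refine ⟨I, fun i j hi hj => ?_⟩
  have h1 := hI i hi j hj
  rw [dist_eq_norm] at h1
  have hsq := pow_le_pow_left₀ (norm_nonneg _) h1.le 2
  rw [norm_formEmbed_sub_sq_trialState hL (Ψ (φ i)) (Ψ (φ j)), Real.sq_sqrt hδ.le] at hsq
  -- finiteness of the squared distance (≤ 4)
  have hfin : ∫⁻ X in cellN N L, ((‖(Ψ (φ i)).ψ X - (Ψ (φ j)).ψ X‖₊ : ℝ≥0∞)) ^ 2 ≠ ⊤ := by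
    have h4 := lintegral_cellN_sq_add_add_sub L (Ψ (φ i)).contDiff.continuous (Ψ (φ j)).contDiff.continuous
    rw [(Ψ (φ i)).norm_eq, (Ψ (φ j)).norm_eq] at h4
    refine ne_top_of_le_ne_top (by norm_num : (2 * 1 + 2 * 1 : ℝ≥0∞) ≠ ⊤) ?_
    rw [← h4]
    exact le_add_self
  rw [← ENNReal.ofReal_toReal hfin]
  exact ENNReal.ofReal_le_ofReal hsq

/-! ### (P2') Increments of the truncated ground-state energies -/

/-- Monotone sequences in `ℝ≥0∞` bounded by a finite `B` have uniformly small increments beyond some index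
(they converge to their supremum). [folklore] -/
theorem exists_increment_le {E : ℕ → ℝ≥0∞} (hmono : Monotone E) {B : ℝ≥0∞} (hB : B ≠ ⊤)
    (hle : ∀ n, E n ≤ B) {δ : ℝ≥0∞} (hδ : 0 < δ) :
    ∃ I : ℕ, ∀ m n : ℕ, I ≤ m → E n - E m ≤ δ := by
  have hS : (⨆ n, E n) ≠ ⊤ := ne_top_of_le_ne_top hB (iSup_le hle)
  obtain ⟨I, hI⟩ := (ENNReal.tendsto_atTop hS).1 (tendsto_atTop_iSup hmono) δ hδ
  refine ⟨I, fun m n hm => ?_⟩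
  have h1 : E n ≤ ⨆ n, E n := le_iSup E n
  have h2 : (⨆ n, E n) - δ ≤ E m := (hI m hm).1
  rw [tsub_le_iff_right]
  calc E n ≤ ⨆ n, E n := h1
    _ ≤ (⨆ n, E n) - δ + δ := le_tsub_add
    _ ≤ E m + δ := add_le_add h2 le_rfl
    _ = δ + E m := add_comm _ _

/-! ### (P3) Pointwise domination, absolute continuity, bookkeeping -/

/-- Pointwise domination of a kinetic density by a reference function and the difference:
`|∇b|² ≤ 2(|∇a|² + |∇(b - a)|²)` (parallelogram law `kineticDensity_fun_add_add_sub`, dropping a square).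
[folklore] -/
theorem kineticDensity_le_two_mul {a b : Config N → ℂ} (ha : Differentiable ℝ a)
    (hb : Differentiable ℝ b) (X : Config N) :
    kineticDensity b X ≤ 2 * (kineticDensity a X + kineticDensity (fun Y => b Y - a Y) X) := by
  have h := kineticDensity_fun_add_add_sub ha (hb.fun_sub ha) X
  have hab : (fun Y => a Y + (b Y - a Y)) = b := funext fun Y => add_sub_cancel (a Y) (b Y)
  rw [hab] at h
  rw [← h]
  exact le_self_add

/-- Absolute continuity of a finite integral on the cell along a shrinking measurable family whose limit is
null inside the cell: `∫_{S k ∩ cell} f → 0` (`tendsto_setLIntegral_zero` for `volume|_cell` and continuity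
from above of the finite measure `volume|_cell`). [folklore] -/
theorem tendsto_setLIntegral_inter_cellN_zero {f : Config N → ℝ≥0∞}
    (hf : ∫⁻ X in cellN N L, f X ≠ ⊤) (S : ℕ → Set (Config N)) (hS : ∀ k, MeasurableSet (S k))
    (hanti : Antitone S) (hnull : volume ((⋂ k, S k) ∩ cellN N L) = 0) :
    Tendsto (fun k => ∫⁻ X in S k ∩ cellN N L, f X) atTop (𝓝 0) := by
  have hfin : volume (cellN N L) ≠ ⊤ := by
    rw [volume_cellN]; exact ENNReal.pow_ne_top (ENNReal.pow_ne_top ENNReal.ofReal_ne_top)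
  have h0 : (volume.restrict (cellN N L)) (S 0) ≠ ⊤ := by
    rw [Measure.restrict_apply (hS 0)]
    exact ne_top_of_le_ne_top hfin (measure_mono Set.inter_subset_right)
  have hmeas : Tendsto ((volume.restrict (cellN N L)) ∘ S) atTop (𝓝 0) := by
    have h := tendsto_measure_iInter_atTop (μ := volume.restrict (cellN N L))
      (fun k => (hS k).nullMeasurableSet) hanti ⟨0, h0⟩
    rwa [Measure.restrict_apply (MeasurableSet.iInter hS), hnull] at h
  refine (tendsto_setLIntegral_zero (μ := volume.restrict (cellN N L)) hf hmeas).congr fun k => ?_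
  rw [Measure.restrict_restrict (hS k)]

/-- The `ε/2 + ε/4 + ε/4` bookkeeping of the tightness estimate, in `ℝ≥0∞`:
`2a + 2(2d + Bm) ≤ ε` once `a ≤ ε/4`, `d ≤ ε/16`, `m ≤ ε/(8(B+1))`. [folklore] -/
theorem bookkeeping {ε : ℝ} (hε : 0 < ε) {B : ℝ≥0∞} (hB : B ≠ ⊤) {a d m : ℝ≥0∞}
    (ha : a ≤ ENNReal.ofReal (ε / 4)) (hd : d ≤ ENNReal.ofReal (ε / 16))
    (hm : m ≤ ENNReal.ofReal (ε / (8 * (B.toReal + 1)))) :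
    2 * a + 2 * (2 * d + B * m) ≤ ENNReal.ofReal ε := by
  have hb : 0 ≤ B.toReal := ENNReal.toReal_nonneg
  have hBm : B * m ≤ ENNReal.ofReal (ε / 8) := by
    calc B * m ≤ ENNReal.ofReal B.toReal * ENNReal.ofReal (ε / (8 * (B.toReal + 1))) := by
          rw [ENNReal.ofReal_toReal hB]; gcongr
      _ = ENNReal.ofReal (B.toReal * (ε / (8 * (B.toReal + 1)))) :=
          (ENNReal.ofReal_mul hb).symm
      _ ≤ ENNReal.ofReal (ε / 8) := ENNReal.ofReal_le_ofReal (by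
          rw [mul_div_assoc', div_le_div_iff₀ (by positivity) (by positivity)]
          nlinarith)
  calc 2 * a + 2 * (2 * d + B * m)
      ≤ 2 * ENNReal.ofReal (ε / 4) + 2 * (2 * ENNReal.ofReal (ε / 16) + ENNReal.ofReal (ε / 8)) := by
        gcongr
    _ = ENNReal.ofReal ε := by
        have h2 : ∀ x : ℝ, 2 * ENNReal.ofReal x = ENNReal.ofReal (2 * x) := fun x => by
          rw [ENNReal.ofReal_mul (by norm_num : (0 : ℝ) ≤ 2), ENNReal.ofReal_ofNat]
        rw [h2 (ε / 16), ← ENNReal.ofReal_add (by positivity) (by positivity), h2, h2,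
          ← ENNReal.ofReal_add (by positivity) (by positivity)]
        congr 1
        ring

end KineticTightness

open KineticTightness

/-- **`stub_truncationMinimisersKineticTightness`** (nodes P1 + P3 of the (α') plan of line
`third-law-current-floor`). For a measurable pair potential `v`, `L > 0`, `B < ⊤` and exact minimisers `Ψₙ` of
the truncated periodic energies `E_{min(v,n)}` at `(N, L)` with energies `≤ B`, there is a subsequence `φ` along
which the kinetic energy is TIGHT with respect to every shrinking measurable family `S k` with Lebesgue-null limit
in the cell: `∀ ε > 0 ∃ k₀ i₀ ∀ k ≥ k₀ ∀ i ≥ i₀, ∫_{S k ∩ cell} |∇Ψ_{φ i}|² ≤ ε`. (`L²`-Cauchy subsequence by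
Rellich, gradient-Cauchy estimate + convergence of the monotone bounded energies `E₀(vₙ)`, pointwise
`|∇Ψᵢ|² ≤ 2|∇Ψ_{i₀}|² + 2|∇(Ψᵢ − Ψ_{i₀})|²`, absolute continuity of `∫_cell |∇Ψ_{i₀}|² < ⊤`.) [folklore] -/
theorem stub_truncationMinimisersKineticTightness :
    ∀ (v : ℝ → ℝ≥0∞), Measurable v → ∀ (N : ℕ) (L : ℝ), 0 < L → ∀ B : ℝ≥0∞, B ≠ ⊤ →
      ∀ Ψ : ℕ → PeriodicTrialState N L,
        (∀ n : ℕ, periodicEnergy (fun r => min (v r) (n : ℝ≥0∞)) (Ψ n) =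
          periodicGroundStateEnergy (fun r => min (v r) (n : ℝ≥0∞)) N L) →
        (∀ n : ℕ, periodicEnergy (fun r => min (v r) (n : ℝ≥0∞)) (Ψ n) ≤ B) →
        ∃ φ : ℕ → ℕ, StrictMono φ ∧
          ∀ S : ℕ → Set (Config N), (∀ k, MeasurableSet (S k)) → Antitone S →
            volume ((⋂ k, S k) ∩ cellN N L) = 0 →
            ∀ ε : ℝ, 0 < ε → ∃ k₀ i₀ : ℕ, ∀ k i : ℕ, k₀ ≤ k → i₀ ≤ i →
              ∫⁻ X in S k ∩ cellN N L, kineticDensity (Ψ (φ i)).ψ X ≤ ENNReal.ofReal ε := by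
  intro v hv N L hL B hB Ψ hmin hΨB
  -- (P1) the `L²(cell)`-Cauchy subsequence
  obtain ⟨φ, hφ, hC⟩ := exists_subseq_sq_cauchy hv hL hB Ψ hΨB
  refine ⟨φ, hφ, fun S hS hanti hnull ε hε => ?_⟩
  -- (P2') the truncated ground-state energies are monotone and `≤ B`
  have hEmono : Monotone fun n : ℕ => periodicGroundStateEnergy (fun r => min (v r) (n : ℝ≥0∞)) N L :=
    fun m n hmn => periodicGroundStateEnergy_mono_of_le fun r =>
      min_le_min le_rfl (by exact_mod_cast hmn)
  have hEle : ∀ n : ℕ, periodicGroundStateEnergy (fun r => min (v r) (n : ℝ≥0∞)) N L ≤ B :=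
    fun n => (hmin n).symm.le.trans (hΨB n)
  obtain ⟨I₁, hI₁⟩ := exists_increment_le hEmono hB hEle
    (ENNReal.ofReal_pos.2 (by positivity : (0 : ℝ) < ε / 16))
  obtain ⟨I₂, hI₂⟩ := hC (ε / (8 * (B.toReal + 1))) (by positivity)
  -- the reference index `i₀` and the tail index `k₀` of the fixed function `Ψ (φ i₀)`
  set i₀ : ℕ := max I₁ I₂
  have hkinfin : ∫⁻ X in cellN N L, kineticDensity (Ψ (φ i₀)).ψ X ≠ ⊤ :=
    ne_top_of_le_ne_top hB ((lintegral_mono fun _ => le_self_add).trans (hΨB (φ i₀)))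
  obtain ⟨k₀, hk₀⟩ := ENNReal.tendsto_atTop_zero.1
    (tendsto_setLIntegral_inter_cellN_zero hkinfin S hS hanti hnull) (ENNReal.ofReal (ε / 4))
    (ENNReal.ofReal_pos.2 (by positivity))
  refine ⟨k₀, i₀, fun k i hk hi => ?_⟩
  have hI₁i₀ : I₁ ≤ φ i₀ := ((le_max_left I₁ I₂).trans (hφ.id_le i₀))
  have hI₂i₀ : I₂ ≤ i₀ := le_max_right I₁ I₂
  -- (P2) the gradient-Cauchy estimate between `Ψ (φ i₀)` and `Ψ (φ i)`
  have hgrad := stub_truncationMinimisersGradientCauchy v hv N L (φ i₀) (φ i) (hφ.monotone hi) (Ψ (φ i₀))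
    (Ψ (φ i)) (hmin (φ i₀)) (hmin (φ i)) (ne_top_of_le_ne_top hB (hΨB (φ i)))
  have hdiff : ∫⁻ X in cellN N L, kineticDensity (fun Y => (Ψ (φ i)).ψ Y - (Ψ (φ i₀)).ψ Y) X ≤
      2 * ENNReal.ofReal (ε / 16) + B * ENNReal.ofReal (ε / (8 * (B.toReal + 1))) :=
    hgrad.trans (add_le_add (mul_le_mul_right (hI₁ (φ i₀) (φ i) hI₁i₀) 2)
      (mul_le_mul' (hEle (φ i₀)) (hI₂ i i₀ (hI₂i₀.trans hi) hI₂i₀)))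
  -- (P3) pointwise domination, integration over `S k ∩ cell`, bookkeeping
  have hdi : Differentiable ℝ (Ψ (φ i)).ψ := (Ψ (φ i)).contDiff.differentiable one_ne_zero
  have hdi₀ : Differentiable ℝ (Ψ (φ i₀)).ψ := (Ψ (φ i₀)).contDiff.differentiable one_ne_zero
  calc ∫⁻ X in S k ∩ cellN N L, kineticDensity (Ψ (φ i)).ψ X
      ≤ ∫⁻ X in S k ∩ cellN N L, 2 * (kineticDensity (Ψ (φ i₀)).ψ X +
          kineticDensity (fun Y => (Ψ (φ i)).ψ Y - (Ψ (φ i₀)).ψ Y) X) :=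
        lintegral_mono fun X => kineticDensity_le_two_mul hdi₀ hdi X
    _ = 2 * (∫⁻ X in S k ∩ cellN N L, kineticDensity (Ψ (φ i₀)).ψ X) +
          2 * ∫⁻ X in S k ∩ cellN N L, kineticDensity (fun Y => (Ψ (φ i)).ψ Y - (Ψ (φ i₀)).ψ Y) X := by
        rw [lintegral_const_mul' _ _ ENNReal.ofNat_ne_top, lintegral_add_left (measurable_kineticDensity_of_any _),
          mul_add]
    _ ≤ 2 * (∫⁻ X in S k ∩ cellN N L, kineticDensity (Ψ (φ i₀)).ψ X) +
          2 * ∫⁻ X in cellN N L, kineticDensity (fun Y => (Ψ (φ i)).ψ Y - (Ψ (φ i₀)).ψ Y) X :=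
        add_le_add le_rfl (mul_le_mul_right (lintegral_mono_set Set.inter_subset_right) 2)
    _ ≤ 2 * ENNReal.ofReal (ε / 4) +
          2 * (2 * ENNReal.ofReal (ε / 16) + B * ENNReal.ofReal (ε / (8 * (B.toReal + 1)))) :=
        add_le_add (mul_le_mul_right (hk₀ k hk) 2) (mul_le_mul_right hdiff 2)
    _ ≤ ENNReal.ofReal ε := bookkeeping hε hB le_rfl le_rfl le_rfl

end Summit.AtomisticToContinuum.BoseEinsteinCondensation.Cruxes.HardCoreExtension.ThirdLawCurrentFloor

end
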